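import Summits.ValiantsHypothesis.ValiantsHypothesis.Theorems.LacunarySymmetroidMatrixDescartesIndexOnePsdAtRoots

/-!
# `MatrixDescartes` (stmt-ValiantsHypothesis-18050) — pivot column at index one: THE SIGN OF THE DETERMINANT DECIDES DEFINITENESS
# (`F(x) ⪰ 0 ⟺ det F(x) ≥ 0` on `(0, ∞)`), so node types ALTERNATE along the positive axis

HONEST FRAMING.  Cell `pub-symmetroid`, seat `val-sym-mdr-p2` (gen 23); helper file `--supports` the crux
`Theses.LacunarySymmetroid.MatrixDescartes` (OPEN), NO closure claim.  Strengthens this seat's `…IndexOnePsdAtRoots` (p678011: `det F(x₀) = 0 ⇒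
F(x₀) ⪰ 0`) for conjb-1's index-one pivot column.  Nothing here bears on `MatrixDescartes` in its window, on `stub_twoSided`, on
`DoorA26` / `DoorA34`, the census registers, or `VP ≠ VNP`.

CONTENT.
* `posSemidef_sub_smul_vecMulVec_iff_det_nonneg` (linear algebra): `D ≻ 0`, `c ≥ 0` ⇒ (`D − c·w wᵀ ⪰ 0 ⟺ 0 ≤ det(D − c·w wᵀ)`).
  (⇐: `det = det D·(1 − c wᵀD⁻¹w) ≥ 0` gives `c·wᵀD⁻¹w ≤ 1`, then the one-square Cauchy–Schwarz of p678011 with `u = D⁻¹w`; ⇒: Mathlib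
  `PosSemidef.det_nonneg`.)
* **`pivot_posSemidef_iff_det_nonneg`**: for an index-one pivot pencil (`J + w wᵀ ⪰ 0`, `Pₖ ⪰ 0`, `(J + w wᵀ) + ∑ Pₖ ≻ 0`) and `x > 0`:
  `F(x) ⪰ 0 ⟺ 0 ≤ det F(x)`.  So on `(0,∞)` the sign of `det F` IS the inertia (`+` : `F ≻ 0` or PSD-singular, `−` : exactly one negative
  eigenvalue), the positive roots are the boundary points of `{det F < 0}`, and — with p678654/NodeType — consecutive simple roots have
  OPPOSITE node types (ascending ⟺ `det F` increases through `0` ⟺ `W_e < 0`): the index-one node sequence is forced to alternate, which is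
  why the chain method's «same type ⇒ independent» cannot hold class-wise beyond `2m` here and the count must come from the dents.

[folklore] Elementary linear algebra over Mathlib.  Axioms `propext`, `Classical.choice`, `Quot.sound`.
-/

set_option linter.dupNamespace false

namespace Summit.ValiantsHypothesis.ValiantsHypothesis.Theorems.LacunarySymmetroidMatrixDescartes.SecularRolle

open Polynomial Matrix Finset
open scoped BigOperators

variable {m K : ℕ}

/-- `det (D − c·w wᵀ) = det D · (1 − c · wᵀ D⁻¹ w)` for invertible `D` (real matrices). [folklore] -/
theorem det_sub_smul_vecMulVec_eq {D : Matrix (Fin m) (Fin m) ℝ} (hD : IsUnit D.det) (c : ℝ) (w : Fin m → ℝ) :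
    (D - c • vecMulVec w w).det = D.det * (1 - c * (w ⬝ᵥ (D⁻¹ *ᵥ w))) := by
  have h : D - c • vecMulVec w w = D + vecMulVec (-(c • w)) w := by
    have : vecMulVec (-(c • w)) w = -(c • vecMulVec w w) := by ext i j; simp [vecMulVec_apply, mul_assoc]
    rw [this, sub_eq_add_neg]
  rw [h, Literature.LinearAlgebra.Matrix.det_add_vecMulVec_adjugate, adjugate_eq_det_smul_inv hD, Matrix.smul_mulVec,
    Matrix.mulVec_neg, Matrix.mulVec_smul, smul_neg, dotProduct_neg, dotProduct_smul, dotProduct_smul, smul_eq_mul,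
    smul_eq_mul]
  ring

/-- **`D ≻ 0`, `c ≥ 0`: `D − c·w wᵀ ⪰ 0 ⟺ 0 ≤ det (D − c·w wᵀ)`.** [folklore] -/
theorem posSemidef_sub_smul_vecMulVec_iff_det_nonneg {D : Matrix (Fin m) (Fin m) ℝ} (hD : D.PosDef) {c : ℝ} (hc : 0 ≤ c)
    (w : Fin m → ℝ) : (D - c • vecMulVec w w).PosSemidef ↔ 0 ≤ (D - c • vecMulVec w w).det := by
  refine ⟨fun h => h.det_nonneg, fun hdet => ?_⟩
  have hunit : IsUnit D.det := (Matrix.isUnit_iff_isUnit_det _).mp hD.isUnit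
  -- `u = D⁻¹ w`, `D u = w`, `q = uᵀ D u = wᵀ D⁻¹ w ≥ 0`, and `c q ≤ 1` from the determinant
  set u : Fin m → ℝ := D⁻¹ *ᵥ w with hu
  have hDu : D *ᵥ u = w := by rw [hu, Matrix.mulVec_mulVec, Matrix.mul_nonsing_inv _ hunit, Matrix.one_mulVec]
  have hsymm := dotProduct_mulVec_comm hD.1
  set q : ℝ := u ⬝ᵥ (D *ᵥ u) with hq
  have hq0 : 0 ≤ q := by rw [hq]; simpa using hD.posSemidef.dotProduct_mulVec_nonneg u
  have hqw : w ⬝ᵥ (D⁻¹ *ᵥ w) = q := by rw [hq, hDu, ← hu, dotProduct_comm]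
  have hcq : c * q ≤ 1 := by
    rw [det_sub_smul_vecMulVec_eq hunit, hqw] at hdet
    have hdpos : 0 < D.det := hD.det_pos
    nlinarith
  -- Hermitian part
  have hH : (D - c • vecMulVec w w).IsHermitian := by
    have h2 : (c • vecMulVec w w : Matrix (Fin m) (Fin m) ℝ).IsHermitian := by
      unfold Matrix.IsHermitian; ext i j; simp [vecMulVec_apply, mul_comm]
    exact hD.1.sub h2
  refine PosSemidef.of_dotProduct_mulVec_nonneg hH fun v => ?_
  obtain ⟨b, hb⟩ : ∃ b : ℝ, b = u ⬝ᵥ (D *ᵥ v) := ⟨_, rfl⟩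
  have hb' : w ⬝ᵥ v = b := by rw [hb, hsymm u v, hDu, dotProduct_comm]
  -- one square: (q v − b u)ᵀ D (q v − b u) = q (q vᵀDv − b²) ≥ 0
  have hsq : 0 ≤ (q • v - b • u) ⬝ᵥ (D *ᵥ (q • v - b • u)) := by
    simpa using hD.posSemidef.dotProduct_mulVec_nonneg (q • v - b • u)
  have hexp : (q • v - b • u) ⬝ᵥ (D *ᵥ (q • v - b • u)) = q * (q * (v ⬝ᵥ (D *ᵥ v)) - b * b) := by
    rw [Matrix.mulVec_sub, Matrix.mulVec_smul, Matrix.mulVec_smul, dotProduct_sub, sub_dotProduct, sub_dotProduct,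
      dotProduct_smul, dotProduct_smul, dotProduct_smul, dotProduct_smul, smul_dotProduct, smul_dotProduct,
      smul_dotProduct, smul_dotProduct]
    simp only [smul_eq_mul]
    rw [hsymm v u, ← hb, ← hq]
    ring
  have hform : star v ⬝ᵥ ((D - c • vecMulVec w w) *ᵥ v) = v ⬝ᵥ (D *ᵥ v) - c * (b * b) := by
    rw [star_trivial, Matrix.sub_mulVec, Matrix.smul_mulVec, vecMulVec_mulVec_eq, dotProduct_sub, smul_smul,
      dotProduct_smul, smul_eq_mul, dotProduct_comm v w, hb']
    ring
  rw [hform]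
  have hvv : 0 ≤ v ⬝ᵥ (D *ᵥ v) := by simpa using hD.posSemidef.dotProduct_mulVec_nonneg v
  rcases eq_or_lt_of_le hq0 with hq00 | hqpos
  · -- `q = 0`: then `b = 0` (from the square with `q = 0`... use `u = 0`): `q = uᵀDu = 0` with `D ≻ 0` forces `u = 0`, so `b = 0`
    have hu0 : u = 0 := by
      by_contra hne
      have := hD.dotProduct_mulVec_pos hne
      rw [star_trivial] at this
      linarith [this, hq00]
    have hb0 : b = 0 := by rw [hb, hu0]; simp
    rw [hb0]; simpa using hvv
  · -- `q > 0`: `q·vᵀDv ≥ b²` and `c b² ≤ c q vᵀDv ≤ vᵀDv`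
    have h1 : b * b ≤ q * (v ⬝ᵥ (D *ᵥ v)) := by
      have : 0 ≤ q * (q * (v ⬝ᵥ (D *ᵥ v)) - b * b) := by rw [← hexp]; exact hsq
      nlinarith
    nlinarith [mul_le_mul_of_nonneg_left h1 hc, mul_le_mul_of_nonneg_right hcq hvv]

/-- **THE SIGN OF THE DETERMINANT DECIDES DEFINITENESS** for index-one pivot pencils: `J + w wᵀ ⪰ 0`, `Pₖ ⪰ 0`,
`(J + w wᵀ) + ∑ Pₖ ≻ 0`, `x > 0` ⇒ (`x^e J + ∑ x^{dₖ} Pₖ ⪰ 0 ⟺ 0 ≤ det (x^e J + ∑ x^{dₖ} Pₖ)`). [folklore] -/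
theorem pivot_posSemidef_iff_det_nonneg (e : ℕ) (d : Fin K → ℕ) {J : Matrix (Fin m) (Fin m) ℝ} {w : Fin m → ℝ}
    {P : Fin K → Matrix (Fin m) (Fin m) ℝ} (hJ : (J + vecMulVec w w).PosSemidef) (hP : ∀ k, (P k).PosSemidef)
    (hpd : (J + vecMulVec w w + ∑ k, P k).PosDef) {x : ℝ} (hx : 0 < x) :
    (x ^ e • J + ∑ k, x ^ d k • P k).PosSemidef ↔ 0 ≤ (x ^ e • J + ∑ k, x ^ d k • P k).det := by
  have hmat : x ^ e • J + ∑ k, x ^ d k • P k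
      = (x ^ e • (J + vecMulVec w w) + ∑ k, x ^ d k • P k) - x ^ e • vecMulVec w w := by
    rw [smul_add]; abel
  rw [hmat]
  exact posSemidef_sub_smul_vecMulVec_iff_det_nonneg (skeleton_posDef e d hJ hP hpd hx) (pow_nonneg hx.le e) w

/-- In polynomial language: for `x > 0`, `F(x) ⪰ 0 ⟺ 0 ≤ (det F)(x)` for the pivot pencil `F = X^e J + ∑ X^{dₖ} Pₖ`. [folklore] -/
theorem pivot_posSemidef_iff_eval_det_nonneg (e : ℕ) (d : Fin K → ℕ) {J : Matrix (Fin m) (Fin m) ℝ} {w : Fin m → ℝ}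
    {P : Fin K → Matrix (Fin m) (Fin m) ℝ} (hJ : (J + vecMulVec w w).PosSemidef) (hP : ∀ k, (P k).PosSemidef)
    (hpd : (J + vecMulVec w w + ∑ k, P k).PosDef) {x : ℝ} (hx : 0 < x) :
    (x ^ e • J + ∑ k, x ^ d k • P k).PosSemidef
      ↔ 0 ≤ (Matrix.det (((X : ℝ[X]) ^ e) • J.map Polynomial.C
          + ∑ k, ((X : ℝ[X]) ^ d k) • (P k).map Polynomial.C)).eval x := by
  rw [det_pivot_eval, pivot_posSemidef_iff_det_nonneg e d hJ hP hpd hx]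

end Summit.ValiantsHypothesis.ValiantsHypothesis.Theorems.LacunarySymmetroidMatrixDescartes.SecularRolle
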